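import Summits.BirchSwinnertonDyer.BirchSwinnertonDyer.Theses.AdditiveKolyvaginRoad
import Summits.BirchSwinnertonDyer.BirchSwinnertonDyer.Theorems.KatoDescentTamePotSupersingularDefs
import Literature.NumberTheory.EllipticCurves.WZhang2014.KolyvaginNonvanishing

/-!
# Sketch — crux idea `middle-copy-fusion` for KPA′ (stmt-BirchSwinnertonDyer-21400), crux-ideate r1 seat 2 g28

On the finite-flat non-split cell at `p = 5` (Kodaira II* at 5: `v_5(Δ_min) = 10`) with an ELLIPTIC
5-ORDINARY AVATAR `X` of conductor `M = N/25` (`X[5] ≅ W[5]`), the optimal curve `E_W ⊂ J₀(N)` meets the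
MIDDLE degeneracy copy `B_5^*(E_X) ⊂ J₀(N)` in its full 5-torsion: `E_W[5] = B_5^*(E_X[5])` (kit j319951:
12/12 II* frames N ≤ 1300; 0/2 on the split type-III controls).  Dually the optimal quotient map of `W`
factors mod 5 through `B_{5,*}` and the quotient map of `X`, so the mod-5 Kolyvagin systems of `W` and `X`
over `K` COINCIDE up to a unit (`AvatarKolyvaginTransport`), and W. Zhang's Theorem 1.1 for `X`
(tree fact `WZhang2014.thm11_exists_kolyvaginClass_one_ne_zero`, rank-free) gives KPA′ for `W` on the cell
(`kpaOnCell_of`, kernel-checked composition below).  Nothing here is proved about BSD.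
-/

namespace Summit.BirchSwinnertonDyer.BirchSwinnertonDyer.Cruxes.KolyvaginPrimitiveAdditive.MiddleCopyFusion

open WeierstrassCurve Literature.NumberTheory.EllipticCurves Literature.NumberTheory.EllipticCurves.ModularForms

/-- THE CELL.  `X` is an elliptic `p`-ordinary avatar of `W` one level down at `p`: traces congruent mod `p`
away from `p·N_W·N_X`, `N_W = p²·N_X`, `X` good ordinary at `p`, and `W` of Kodaira type II* at `p`
(`v_p(Δ_min) = 10`; at `p = 5` this is the finite-flat locus, and it EXCLUDES the split type-III frames
525d1 ∕ 800h1 where middle-copy fusion fails). -/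
def IsOrdinaryEllipticAvatar (p : ℕ) [Fact p.Prime] (W X : WeierstrassCurve ℚ) [W.IsElliptic]
    [W.IsGloballyMinimal] [X.IsElliptic] [X.IsGloballyMinimal] : Prop :=
  Summit.BirchSwinnertonDyer.BirchSwinnertonDyer.Theorems.IsCongruentModP p W X ∧
    p ^ 2 * X.conductorNorm ℤ = W.conductorNorm ℤ ∧
    X.HasGoodReductionAtPrime p ∧ ¬ (p : ℤ) ∣ X.frobeniusTrace p ∧
    padicValInt p W.minimalDiscriminantInt = 10

/-- (KT) AVATAR KOLYVAGIN TRANSPORT — the First lemma of the line.  On the cell, a non-zero mod-`p`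
Kolyvagin class of the avatar `X` over `K` (the conclusion shape of Zhang's Thm. 1.1 for `X`) yields a
non-zero mod-`p` Kolyvagin class of `W` over the same `K` for EVERY admissible parametrisation datum of `W`
(the conclusion shape of KPA′).  Mechanism: middle-copy fusion `E_W[p] = B_p^*(E_X[p])` in `J₀(N_W)` (forced by
the mod-`p` multiplicity count `t(N) = 3·t(M)` + Ihara at `p²`), its Cartier dual (the optimal quotient map of
`W` factors mod `p` through `B_{p,*}` and the quotient map of `X`), `B_{p,*}` of a conductor-`n` Heegner point of
level `N` = a `Gal(K_n/K)`-translate of the conductor-`n` Heegner point of level `M`, Kolyvagin primes of `W`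
and `X` coincide (`p` splits in `K`).  Stated at `p = 5` (the certified cell). -/
def AvatarKolyvaginTransport : Prop :=
  ∀ (W X : WeierstrassCurve ℚ) [W.IsElliptic] [W.IsGloballyMinimal] [NeZero (W.conductorNorm ℤ)]
    [X.IsElliptic] [X.IsGloballyMinimal] [NeZero (X.conductorNorm ℤ)]
    (p : ℕ) [Fact p.Prime] (K : Type) [Field K] [NumberField K]
    (Dt : ModularParametrizationData W (W.conductorNorm ℤ)) (β : ℤ) (ι : K →+* ℂ),
    p = 5 → IsOrdinaryEllipticAvatar p W X → W.HasSurjectiveModNGaloisRep p →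
    IsImaginaryQuadratic K → SatisfiesHeegnerHypothesis (W.conductorNorm ℤ) K →
    (4 * (W.conductorNorm ℤ : ℤ)) ∣ β ^ 2 - NumberField.discr K → ¬ (p : ℤ) ∣ Dt.c →
    (∃ (Dt' : ModularParametrizationData X (X.conductorNorm ℤ)) (β' : ℤ) (ι' : K →+* ℂ) (n : ℕ)
        (d' : KolyvaginHeegnerData Dt' β' ι' n),
        KolyvaginDescent.KolSupp (Zhang2014.IsKolyvaginPrime (X.conductorNorm ℤ) X K p) n ∧
          d'.kolyvaginClass (Fact.out : p.Prime) 1 ≠ 0) →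
    ∃ (n : ℕ) (d : KolyvaginHeegnerData Dt β ι n),
      KolyvaginDescent.KolSupp (Zhang2014.IsKolyvaginPrime (W.conductorNorm ℤ) W K p) n ∧
        d.kolyvaginClass (Fact.out : p.Prime) 1 ≠ 0

/-- (INH) AVATAR INHERITANCE — support, routine: the avatar inherits from `W` the hypotheses of Zhang's
Thm. 1.1 (surjectivity: same `ρ̄`; ♠: the multiplicative primes of `X` are those of `W` and `ρ̄` is ramified
there; `p ∤ d_K` and `(d_K, N_X) = 1`, Heegner hypothesis for `N_X ∣ N_W`: every `ℓ ∣ N_W` splits in `K`). -/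
def AvatarInheritance : Prop :=
  ∀ (W X : WeierstrassCurve ℚ) [W.IsElliptic] [W.IsGloballyMinimal] [NeZero (W.conductorNorm ℤ)]
    [X.IsElliptic] [X.IsGloballyMinimal] [NeZero (X.conductorNorm ℤ)]
    (p : ℕ) [Fact p.Prime] (K : Type) [Field K] [NumberField K],
    p = 5 → IsOrdinaryEllipticAvatar p W X → W.HasSurjectiveModNGaloisRep p →
    (∀ (ℓ : ℕ) [Fact ℓ.Prime], W.HasMultiplicativeReductionAtPrime ℓ →
      ¬ p ∣ padicValInt ℓ W.minimalDiscriminantInt) →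
    (∃ (ℓ₁ ℓ₂ : ℕ) (_ : Fact ℓ₁.Prime) (_ : Fact ℓ₂.Prime), ℓ₁ ≠ ℓ₂ ∧
      W.HasMultiplicativeReductionAtPrime ℓ₁ ∧ W.HasMultiplicativeReductionAtPrime ℓ₂) →
    IsImaginaryQuadratic K → SatisfiesHeegnerHypothesis (W.conductorNorm ℤ) K →
    X.HasSurjectiveModNGaloisRep p ∧
      (∀ (ℓ : ℕ) [Fact ℓ.Prime], X.HasMultiplicativeReductionAtPrime ℓ →
        ¬ p ∣ padicValInt ℓ X.minimalDiscriminantInt) ∧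
      (¬ Squarefree (X.conductorNorm ℤ) →
        (∃ (ℓ : ℕ) (_ : Fact ℓ.Prime), X.HasMultiplicativeReductionAtPrime ℓ ∧
            ¬ p ∣ padicValInt ℓ X.minimalDiscriminantInt) ∧
          ∃ (ℓ₁ ℓ₂ : ℕ) (_ : Fact ℓ₁.Prime) (_ : Fact ℓ₂.Prime), ℓ₁ ≠ ℓ₂ ∧
            X.HasMultiplicativeReductionAtPrime ℓ₁ ∧ X.HasMultiplicativeReductionAtPrime ℓ₂) ∧
      ¬ ((p : ℤ) ∣ NumberField.discr K) ∧
      IsCoprime (NumberField.discr K) ((X.conductorNorm ℤ : ℕ) : ℤ) ∧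
      SatisfiesHeegnerHypothesis (X.conductorNorm ℤ) K

/-- KPA′ RESTRICTED TO THE CELL: the crux `KolyvaginPrimitiveAdditive` (route AdditiveKolyvaginRoad) with its
binders verbatim, plus an elliptic `p`-ordinary avatar `X` and `p = 5`. -/
def KPAOnOrdinaryEllipticAvatarCell : Prop :=
  ∀ (W : WeierstrassCurve ℚ) [W.IsElliptic] [W.IsGloballyMinimal] [NeZero (W.conductorNorm ℤ)] (p : ℕ)
    [Fact p.Prime] (K : Type) [Field K] [NumberField K]
    (Dt : ModularParametrizationData W (W.conductorNorm ℤ)) (β : ℤ) (ι : K →+* ℂ)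
    (X : WeierstrassCurve ℚ) [X.IsElliptic] [X.IsGloballyMinimal] [NeZero (X.conductorNorm ℤ)],
    p = 5 → IsOrdinaryEllipticAvatar p W X →
    5 ≤ p → Rank1Residual.Addv W p → W.HasSurjectiveModNGaloisRep p →
    (∀ (ℓ : ℕ) [Fact ℓ.Prime], W.HasMultiplicativeReductionAtPrime ℓ →
      ¬ p ∣ padicValInt ℓ W.minimalDiscriminantInt) →
    (∃ (ℓ₁ ℓ₂ : ℕ) (_ : Fact ℓ₁.Prime) (_ : Fact ℓ₂.Prime), ℓ₁ ≠ ℓ₂ ∧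
      W.HasMultiplicativeReductionAtPrime ℓ₁ ∧ W.HasMultiplicativeReductionAtPrime ℓ₂) →
    ¬ p ∣ W.tamagawaProduct → W.analyticRank = 1 → IsImaginaryQuadratic K → Odd (NumberField.discr K) →
    NumberField.discr K < -4 → SatisfiesHeegnerHypothesis (W.conductorNorm ℤ) K →
    (W.quadraticTwist (NumberField.discr K : ℚ)).entireLFunction 1 ≠ 0 →
    (4 * (W.conductorNorm ℤ : ℤ)) ∣ β ^ 2 - NumberField.discr K → ¬ (p : ℤ) ∣ Dt.c →
    ∃ (n : ℕ) (d : KolyvaginHeegnerData Dt β ι n),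
      KolyvaginDescent.KolSupp (Zhang2014.IsKolyvaginPrime (W.conductorNorm ℤ) W K p) n ∧
        d.kolyvaginClass (Fact.out : p.Prime) 1 ≠ 0

/-- COMPOSITION (kernel-checked, no `sorry`): Zhang's Thm. 1.1 for the avatar (tree fact, rank-free) +
inheritance + transport ⟹ KPA′ on the cell.  No rank split, no `R1`, no Gross–Zagier, no `p`-adic input. -/
theorem kpaOnCell_of
    (hZ : WZhang2014.thm11_exists_kolyvaginClass_one_ne_zero)
    (hI : AvatarInheritance) (hT : AvatarKolyvaginTransport) :
    KPAOnOrdinaryEllipticAvatarCell := by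
  intro W _ _ _ p _ K _ _ Dt β ι X _ _ _ hp5 hcell h5 _hAdd hsurj hS1 hS2 _htam _hrk hK _hodd _hlt hHeeg
    _hL hβ hc
  obtain ⟨hsurjX, hS1X, hS2X, hpdK, hcop, hHeegX⟩ := hI W X p K hp5 hcell hsurj hS1 hS2 hK hHeeg
  have hgood := hcell.2.2.1
  have hord := hcell.2.2.2.1
  obtain ⟨Dt', β', ι', n, d', hsupp, -, hne⟩ :=
    hZ X p h5 hgood hord hsurjX hS1X hS2X K hK hpdK hcop hHeegX
  exact hT W X p K Dt β ι hp5 hcell hsurj hK hHeeg hβ hc ⟨Dt', β', ι', n, d', hsupp, hne⟩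

end Summit.BirchSwinnertonDyer.BirchSwinnertonDyer.Cruxes.KolyvaginPrimitiveAdditive.MiddleCopyFusion
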